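import Literature.MathematicalPhysics.QuantumFieldTheory.BalabanImbrieJaffe1984to88.BIJ88Ineq5144EndChainNSource
import Literature.MathematicalPhysics.QuantumFieldTheory.BalabanImbrieJaffe1984to88.BIJ88Ineq5144EndChainNWalkCount
import Literature.MathematicalPhysics.QuantumFieldTheory.BalabanImbrieJaffe1984to88.BIJ88Ineq5144EndChainDecayToy

/-!
# `BalabanImbrieJaffe1984to88.BIJ88Ineq5144EndChainNToy` — T. Bałaban, J. Imbrie, A. Jaffe, *Effective action and cluster properties of the
abelian Higgs model*, Commun. Math. Phys. **114** (1988) 257–315 [BalabanImbrieJaffe1988], Sect. 5.14 (5.14.4) p. 309–310 [PDF 53–54] with Sect.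
5.13 p. 305–307 [PDF 49–51]: **NON-VACUITY CERTIFICATES FOR THE SIZE-UNIFORM CHAIN INSTANCES, WITHOUT AND WITH A SOURCE, AND WITH PRINT'S
PER-CUBE COUNT** — the clause sets of `BIJ88Ineq5144EndChainNDecay.ineq5144_locAct_endChainN_of_decay` (sourceless), of
`BIJ88Ineq5144EndChainNSource.ineq5144_locAct_endChainN_source_of_decay` (source `ℱ`) and of `BIJ88Ineq5144EndChainNWalkCount.
ineq5144_locAct_endChainN_of_decay_walkCount` (no located surplus) are inhabited by the COUPLED datum of `BIJ88Ineq5144EndChainDecayToy` (p36 g19): sites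
`Fin 4`, cubes `□₀ = {0}`, `□₁ = {1, 2}`, `□₂ = {3}` (block map `![0, 1, 1, 2]`), precision `Δ = 1 + 10⁻²·(path 0–1–2–3)` (`m = 98/100`), one
interaction term `V(φ) = 10⁻³e^{−φ₀²}` on `□₀`, no χ-slots, `θ = 1/10`, `β′ = 1`, `W = 2`, `R = 10⁻²`, `c₁ = 2`, `δ = 10⁻²`, `ds(x,l) = [x ≠ l]`,
corner `Λ′ = univ`; the chain `X″ = {□₀, □₁, □₂}` with `a = 0`, `b = 1`, `n = 2` (neighbour clause: only `□₁` couples to `□₀`; depth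
`|X″| − 2 = 1 ≤ ds` on the qualifying pairs); and, for the source certificate, THE CONSTANT SOURCE `ℱ ≡ 10⁻²` (`F = 10⁻²`) with the row-sum letter
(c) discharged by the lineage's own Combes–Thomas theorems at rate `μ = 0` (`BIJ88Ineq5144EndChainCT.restricted_inv_decay`,
`BIJ88Ineq5144EndChainNSource.interp_inv_decay`: every entry of the restricted and of the full interpolated inverse is `≤ 2/m = 100/49`, so
`c₂ = 400/49`).  Every hypothesis — (b) for all `s` by `BIJ88Ineq5144EndChainDecayToy.toy_decay`, (c) for all `s`, the size-free clauses
`4W³R³c₁²δ² ≤ mθ^{β′}`, `2δ² ≤ θ^{β′}` resp. `4WRρ₁(ρ₁μ + c₂F(1+μ)) ≤ θ^{β′}`, `2δ ≤ θ^{β′}` — is discharged by the kernel.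

statement-level skeleton of published theorems with citation tags; proofs where landed; nothing here is a claim about the Yang–Mills mass gap

PDF held: `paper:balaban1988-cmp114-bij-abelian-higgs-effective-action` (journal page = PDF page + 256); p. 309 (p0053 L14–16), p. 307 (p0051), p. 305 (p0049).

WHAT IS PROVED (unit `lit-balaban-p36`, generation 20 of the Phase-2 proof seat p36; SKELETON rows C2.Eq5.14.3-5.14.4 / C2.Eq5.14.5 of
`HOME/lit-balaban-r16/ROWS-C2-part2.md`, owner r16; 0 definitions, 0 `Prop` facts, theorems only):
**`ineq5144_locAct_endChainN_of_decay_toy`**, **`ineq5144_locAct_endChainN_source_of_decay_toy`**, **`ineq5144_locAct_endChainN_walkCount_toy`**.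
HONEST SCOPE: non-vacuity certificates only (the chain of the datum has three cubes; the size-free clauses are the same for every length).  Imports
`BIJ88Ineq5144EndChainNSource`, `BIJ88Ineq5144EndChainNWalkCount` (p36 g20), `BIJ88Ineq5144EndChainDecayToy` (p36 g19); modifies nothing.  NOT summit
progress; NOT continuum; NOT Clay.  Cell `lit-balaban` Phase 2, seat p36 gen 20 (owner r16, referee ref-5).
-/

noncomputable section

open Finset MeasureTheory Matrix Function Filter
open Literature.MathematicalPhysics.QuantumFieldTheory.Balaban1983to89
open Literature.MathematicalPhysics.QuantumFieldTheory.BalabanImbrieJaffe1984to88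
open B2Eq228Conditioning (In Out resIn resOut glue blkIn blkMix condShift)
open BIJ88Sect5Statements (CutoffProfile)
open BIJ88DirichletForms305 (interpForm)
open BIJ88PolymerRep5134 (corner)
open BIJ88Eq5145CornerModel (slotB slotY)
open BIJ88Eq5145CornerUrsell (cubeIn)
open BIJ88W6PrimeVsupp (actIn)
open BIJ88Ineq5144Located (locAct)
open BIJ88Ineq5144EndChainDecayToy (toy_decay toy_posDef_and_ge)
open BIJ88Ineq5144EndChainCT (restricted_inv_decay)
open BIJ88Ineq5144EndChainNDecay (ineq5144_locAct_endChainN_of_decay)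
open BIJ88Ineq5144EndChainNSource (interp_inv_decay ineq5144_locAct_endChainN_source_of_decay)
open BIJ88Ineq5144EndChainNWalkCount (ineq5144_locAct_endChainN_of_decay_walkCount)

namespace Literature.MathematicalPhysics.QuantumFieldTheory.BalabanImbrieJaffe1984to88.BIJ88Ineq5144EndChainNToy

/-! ## §1 The chain clauses and the row-sum letter on the datum -/

/-- **the neighbour clause on the datum**: a site of `□₁ ∪ □₂` coupled to `□₀` lies in `□₁`. [cite: BalabanImbrieJaffe1988, p.305 (Sect. 5.13)] -/
theorem toy_nbr (l k : Fin 4) (_hl : (![0, 1, 1, 2] : Fin 4 → Fin 3) l ∈ ({0, 1, 2} : Finset (Fin 3)))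
    (hla : (![0, 1, 1, 2] : Fin 4 → Fin 3) l ≠ 0) (hk : (![0, 1, 1, 2] : Fin 4 → Fin 3) k = 0)
    (hΔ : (!![1, 1 / 100, 0, 0; 1 / 100, 1, 1 / 100, 0; 0, 1 / 100, 1, 1 / 100; 0, 0, 1 / 100, 1] : Matrix (Fin 4) (Fin 4) ℝ) l k ≠ 0) :
    (![0, 1, 1, 2] : Fin 4 → Fin 3) l = 1 := by
  fin_cases k <;> simp at hk
  fin_cases l
  · simp at hla
  · rfl
  · norm_num at hΔ
  · norm_num at hΔ

/-- **the depth clause on the datum** (`|X″| − 2 = 1`): the qualifying pairs `(x, l)` are off-diagonal. [cite: BalabanImbrieJaffe1988, p.307 (Sect. 5.13)] -/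
theorem toy_depth (x l : Fin 4)
    (hx : (![0, 1, 1, 2] : Fin 4 → Fin 3) x = 2 ∨ ((![0, 1, 1, 2] : Fin 4 → Fin 3) x ∈ ({0, 1, 2} : Finset (Fin 3)) ∧
      ∃ y, (![0, 1, 1, 2] : Fin 4 → Fin 3) y = 2 ∧
        (!![1, 1 / 100, 0, 0; 1 / 100, 1, 1 / 100, 0; 0, 1 / 100, 1, 1 / 100; 0, 0, 1 / 100, 1] : Matrix (Fin 4) (Fin 4) ℝ) y x ≠ 0))
    (hl : (![0, 1, 1, 2] : Fin 4 → Fin 3) l = 1)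
    (hk : ∃ k, (![0, 1, 1, 2] : Fin 4 → Fin 3) k = 0 ∧
      (!![1, 1 / 100, 0, 0; 1 / 100, 1, 1 / 100, 0; 0, 1 / 100, 1, 1 / 100; 0, 0, 1 / 100, 1] : Matrix (Fin 4) (Fin 4) ℝ) l k ≠ 0) :
    ({0, 1, 2} : Finset (Fin 3)).card - 2 ≤ (fun x l : Fin 4 => if x = l then 0 else 1) x l := by
  rw [show ({0, 1, 2} : Finset (Fin 3)).card - 2 = 1 by decide]
  suffices h : x ≠ l by simp [h]
  rintro rfl
  obtain ⟨k, hk0, hkΔ⟩ := hk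
  fin_cases k <;> simp at hk0
  fin_cases x
  · simp at hl
  · rcases hx with hx | ⟨-, y, hy2, hyΔ⟩
    · simp at hx
    · fin_cases y <;> simp at hy2
      norm_num at hyΔ
  · norm_num at hkΔ
  · simp at hl

/-- **the row-sum letter (c) on the datum, by Combes–Thomas at rate `0`**: for every `s ∈ [0,1]³`, every absolute row sum of the restricted
(`Λ = {1,2,3}`) and of the full interpolated inverse is `≤ 400/49` (each entry `≤ 2/m = 100/49`). [cite: BalabanImbrieJaffe1988, p.305 (Sect. 5.13)] -/
theorem toy_rowSum (s : Fin 3 → ℝ) (hs : ∀ l, 0 ≤ s l ∧ s l ≤ 1) :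
    (∀ x : In (fun x : Fin 4 => (![0, 1, 1, 2] : Fin 4 → Fin 3) x ≠ 0),
      ∑ l, |(blkIn (fun x : Fin 4 => (![0, 1, 1, 2] : Fin 4 → Fin 3) x ≠ 0)
        (interpForm (![0, 1, 1, 2] : Fin 4 → Fin 3)
          (interpForm (![0, 1, 1, 2] : Fin 4 → Fin 3)
            (!![1, 1 / 100, 0, 0; 1 / 100, 1, 1 / 100, 0; 0, 1 / 100, 1, 1 / 100; 0, 0, 1 / 100, 1] : Matrix (Fin 4) (Fin 4) ℝ)
            (corner ℝ (univ : Finset (Fin 3)))) s))⁻¹ x l| ≤ 400 / 49) ∧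
    ∀ k : Fin 4, ∑ l, |(interpForm (![0, 1, 1, 2] : Fin 4 → Fin 3)
          (interpForm (![0, 1, 1, 2] : Fin 4 → Fin 3)
            (!![1, 1 / 100, 0, 0; 1 / 100, 1, 1 / 100, 0; 0, 1 / 100, 1, 1 / 100; 0, 0, 1 / 100, 1] : Matrix (Fin 4) (Fin 4) ℝ)
            (corner ℝ (univ : Finset (Fin 3)))) s)⁻¹ k l| ≤ 400 / 49 := by
  obtain ⟨hΔ, hΔm⟩ := toy_posDef_and_ge
  -- the discrete pseudo-distance: `Δ` has range `1` trivially, every site has `≤ 3` others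
  have hd0 : ∀ i : Fin 4, (fun x y : Fin 4 => if x = y then (0 : ℝ) else 1) i i = 0 := fun i => by simp
  have hdsymm : ∀ i k : Fin 4, (fun x y : Fin 4 => if x = y then (0 : ℝ) else 1) i k =
      (fun x y : Fin 4 => if x = y then (0 : ℝ) else 1) k i := fun i k => by simp only [eq_comm]
  have hdtri : ∀ i j k : Fin 4, (fun x y : Fin 4 => if x = y then (0 : ℝ) else 1) i k ≤
      (fun x y : Fin 4 => if x = y then (0 : ℝ) else 1) i j + (fun x y : Fin 4 => if x = y then (0 : ℝ) else 1) j k := by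
    intro i j k
    simp only []
    split_ifs <;> simp_all
  have hband : ∀ x y : Fin 4, 1 < (fun x y : Fin 4 => if x = y then (0 : ℝ) else 1) x y →
      (!![1, 1 / 100, 0, 0; 1 / 100, 1, 1 / 100, 0; 0, 1 / 100, 1, 1 / 100; 0, 0, 1 / 100, 1] : Matrix (Fin 4) (Fin 4) ℝ) x y = 0 := by
    intro x y h
    exfalso
    simp only [] at h
    split_ifs at h <;> norm_num at h
  have hh : ∀ x y : Fin 4, x ≠ y →
      |(!![1, 1 / 100, 0, 0; 1 / 100, 1, 1 / 100, 0; 0, 1 / 100, 1, 1 / 100; 0, 0, 1 / 100, 1] : Matrix (Fin 4) (Fin 4) ℝ) x y| ≤ 1 / 100 := by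
    intro x y hxy
    fin_cases x <;> fin_cases y <;> first | exact absurd rfl hxy | norm_num
  have hz : ∀ x : Fin 4, ((univ.filter fun y => y ≠ x ∧ (fun x y : Fin 4 => if x = y then (0 : ℝ) else 1) x y ≤ 1).card : ℝ) ≤ 3 := by
    intro x
    have h1 : (univ.filter fun y => y ≠ x ∧ (fun x y : Fin 4 => if x = y then (0 : ℝ) else 1) x y ≤ 1).card ≤
        (univ.filter fun y : Fin 4 => y ≠ x).card :=
      card_le_card fun y hy => by
        simp only [mem_filter, mem_univ, true_and] at hy ⊢
        exact hy.1
    have h2 : (univ.filter fun y : Fin 4 => y ≠ x).card = 3 := by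
      rw [filter_ne', card_erase_of_mem (mem_univ _)]; simp
    exact_mod_cast h1.trans h2.le
  have hsmall : (1 / 100 : ℝ) * 3 * (Real.exp 0 - 1) ≤ (98 / 100) / 2 := by rw [Real.exp_zero]; norm_num
  refine ⟨fun x => ?_, fun k => ?_⟩
  · have hent : ∀ l : In (fun x : Fin 4 => (![0, 1, 1, 2] : Fin 4 → Fin 3) x ≠ 0),
        |(blkIn (fun x : Fin 4 => (![0, 1, 1, 2] : Fin 4 → Fin 3) x ≠ 0)
          (interpForm (![0, 1, 1, 2] : Fin 4 → Fin 3)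
            (interpForm (![0, 1, 1, 2] : Fin 4 → Fin 3)
              (!![1, 1 / 100, 0, 0; 1 / 100, 1, 1 / 100, 0; 0, 1 / 100, 1, 1 / 100; 0, 0, 1 / 100, 1] : Matrix (Fin 4) (Fin 4) ℝ)
              (corner ℝ (univ : Finset (Fin 3)))) s))⁻¹ x l| ≤ 100 / 49 := fun l => by
      have h := restricted_inv_decay (![0, 1, 1, 2] : Fin 4 → Fin 3) (fun x y : Fin 4 => if x = y then (0 : ℝ) else 1) hd0 hdsymm hdtri
        hband (by norm_num) hh hz hΔ (by norm_num) hΔm le_rfl hsmall (univ : Finset (Fin 3)) hs _ x l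
      simp only [zero_mul, neg_zero, Real.exp_zero, mul_one] at h
      exact h.trans (by norm_num)
    calc _ ≤ (univ : Finset (In (fun x : Fin 4 => (![0, 1, 1, 2] : Fin 4 → Fin 3) x ≠ 0))).card • (100 / 49 : ℝ) :=
          sum_le_card_nsmul _ _ _ fun l _ => hent l
      _ ≤ 4 • (100 / 49 : ℝ) := by
          refine nsmul_le_nsmul_left (by norm_num) ?_
          exact (card_univ (α := In (fun x : Fin 4 => (![0, 1, 1, 2] : Fin 4 → Fin 3) x ≠ 0))).le.trans
            ((Fintype.card_subtype_le _).trans (by simp))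
      _ = 400 / 49 := by norm_num
  · have hent : ∀ l : Fin 4, |(interpForm (![0, 1, 1, 2] : Fin 4 → Fin 3)
          (interpForm (![0, 1, 1, 2] : Fin 4 → Fin 3)
            (!![1, 1 / 100, 0, 0; 1 / 100, 1, 1 / 100, 0; 0, 1 / 100, 1, 1 / 100; 0, 0, 1 / 100, 1] : Matrix (Fin 4) (Fin 4) ℝ)
            (corner ℝ (univ : Finset (Fin 3)))) s)⁻¹ k l| ≤ 100 / 49 := fun l => by
      have h := interp_inv_decay (![0, 1, 1, 2] : Fin 4 → Fin 3) (fun x y : Fin 4 => if x = y then (0 : ℝ) else 1) hd0 hdsymm hdtri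
        hband (by norm_num) hh hz hΔ (by norm_num) hΔm le_rfl hsmall (univ : Finset (Fin 3)) hs k l
      simp only [zero_mul, neg_zero, Real.exp_zero, mul_one] at h
      exact h.trans (by norm_num)
    calc _ ≤ (univ : Finset (Fin 4)).card • (100 / 49 : ℝ) := sum_le_card_nsmul _ _ _ fun l _ => hent l
      _ = 400 / 49 := by simp; norm_num

/-! ## §2 The certificates -/

/-- **NON-VACUITY OF THE SIZE-UNIFORM CHAIN INSTANCE (sourceless)**: `BIJ88Ineq5144EndChainNDecay.ineq5144_locAct_endChainN_of_decay` applied to the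
datum, every hypothesis — neighbour clause, depth clause, (b) for all `s`, the two size-free clauses — discharged by the kernel; the statement
displays the NEW step clause `2δ² ≤ θ^{β′}` evaluated on the datum as a conjunct (the located bound itself coincides, as a proposition, with g19's
certificate of the three-cube instance on the same datum). [cite: BalabanImbrieJaffe1988, (5.14.4) p.309–310; p.307 (Sect. 5.13)] -/
theorem ineq5144_locAct_endChainN_of_decay_toy (adj : Fin 3 → Fin 3 → Prop) [DecidableRel adj] (χ : CutoffProfile) (p ek : ℝ)
    (X : Finset (Fin 3)) {t : ℝ} (ht0 : 0 ≤ t) (ht1 : t ≤ 1) {L : Type} [DecidableEq L]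
    (γ : L → ↥(slotB (∅ : Finset Unit) (univ : Finset Unit) (fun _ : ↥(∅ : Finset Unit) ⊕ ↥(univ : Finset Unit) => (0 : Fin 3)) X) ⊕
      ↥(slotY (∅ : Finset Unit) (univ : Finset Unit) (fun _ : ↥(∅ : Finset Unit) ⊕ ↥(univ : Finset Unit) => (0 : Fin 3)) X))
    (H : Finset L) :
    2 * (1 / 100 : ℝ) ^ 2 ≤ (1 / 10 : ℝ) ^ (1 : ℝ) ∧
    |locAct (cubeIn (fun _ : ↥(∅ : Finset Unit) ⊕ ↥(univ : Finset Unit) => (0 : Fin 3)) X ∘ γ)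
        (actIn (![0, 1, 1, 2] : Fin 4 → Fin 3)
          (!![1, 1 / 100, 0, 0; 1 / 100, 1, 1 / 100, 0; 0, 1 / 100, 1, 1 / 100; 0, 0, 1 / 100, 1] : Matrix (Fin 4) (Fin 4) ℝ)
          (0 : Fin 4 → ℝ) adj χ p ek (∅ : Finset Unit) (fun _ _ => (0 : ℝ)) (fun _ => (1 : ℝ)) (univ : Finset Unit)
          (fun _ φ => (1 / 1000 : ℝ) * Real.exp (-(φ 0) ^ 2)) (fun _ : ↥(∅ : Finset Unit) ⊕ ↥(univ : Finset Unit) => (0 : Fin 3))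
          (univ : Finset (Fin 3)) X t γ) H ({0, 1, 2} : Finset (Fin 3))| ≤
      (1 / 10 : ℝ) ^ ((H.card : ℝ) + 1 * ((({0, 1, 2} : Finset (Fin 3)) \
        H.image (cubeIn (fun _ : ↥(∅ : Finset Unit) ⊕ ↥(univ : Finset Unit) => (0 : Fin 3)) X ∘ γ)).card : ℝ)) := by
  obtain ⟨hΔ, hΔm⟩ := toy_posDef_and_ge
  have hVm : Measurable fun φ : Fin 4 → ℝ => (1 / 1000 : ℝ) * Real.exp (-(φ 0) ^ 2) := Continuous.measurable (by fun_prop)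
  have hVb : ∀ φ : Fin 4 → ℝ, |(1 / 1000 : ℝ) * Real.exp (-(φ 0) ^ 2)| ≤ 1 / 1000 := fun φ => by
    rw [abs_of_nonneg (by positivity)]
    exact mul_le_of_le_one_right (by norm_num) (Real.exp_le_one_iff.2 (neg_nonpos.2 (sq_nonneg _)))
  have hG : ∀ i : Fin 3, (univ.filter fun τ : ↥(∅ : Finset Unit) ⊕ ↥(univ : Finset Unit) =>
      (fun _ : ↥(∅ : Finset Unit) ⊕ ↥(univ : Finset Unit) => (0 : Fin 3)) τ = i).card ≤ 1 := fun i =>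
    (card_le_univ _).trans (by simp)
  have hexp : Real.exp (2 * ((1 : ℕ) : ℝ) * (1 / 1000)) ≤ 1 + 4 / 1000 := by
    have h := (abs_le.1 (Real.abs_exp_sub_one_le (x := 2 * ((1 : ℕ) : ℝ) * (1 / 1000)) (by norm_num))).2
    rw [abs_of_pos (by norm_num)] at h
    norm_num at h ⊢
    linarith
  have hvac : Real.exp (2 * ((1 : ℕ) : ℝ) * (1 / 1000)) - 1 ≤ (1 / 10 : ℝ) ^ (2 * (1 : ℝ)) / 2 := by
    rw [show (2 : ℝ) * 1 = (2 : ℕ) by norm_num, Real.rpow_natCast]; norm_num; linarith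
  have hKθ₂ : ∀ Y ∈ (univ : Finset Unit), (fun _ : Unit => (1 / 1000 : ℝ)) Y * Real.exp (2 * ((1 : ℕ) : ℝ) * (1 / 1000)) ≤
      (1 / 10 : ℝ) ^ ((1 : ℝ) + 1) / 2 := fun _ _ => by
    rw [show (1 : ℝ) + 1 = (2 : ℕ) by norm_num, Real.rpow_natCast]
    calc (1 / 1000 : ℝ) * Real.exp (2 * ((1 : ℕ) : ℝ) * (1 / 1000)) ≤ (1 / 1000) * (1 + 4 / 1000) :=
          mul_le_mul_of_nonneg_left hexp (by norm_num)
      _ ≤ (1 / 10 : ℝ) ^ 2 / 2 := by norm_num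
  have hW : ∀ i : Fin 3, (univ.filter fun x : Fin 4 => (![0, 1, 1, 2] : Fin 4 → Fin 3) x = i).card ≤ 2 := by decide
  have hR : ∀ x : Fin 4, ∑ y ∈ univ.filter (fun y => (![0, 1, 1, 2] : Fin 4 → Fin 3) y ≠ (![0, 1, 1, 2] : Fin 4 → Fin 3) x),
      |(!![1, 1 / 100, 0, 0; 1 / 100, 1, 1 / 100, 0; 0, 1 / 100, 1, 1 / 100; 0, 0, 1 / 100, 1] : Matrix (Fin 4) (Fin 4) ℝ) x y| ≤ 1 / 100 := by
    intro x
    rw [Finset.sum_filter, Fin.sum_univ_four]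
    fin_cases x <;> simp
  refine ⟨by rw [Real.rpow_one]; norm_num, ?_⟩
  exact ineq5144_locAct_endChainN_of_decay (![0, 1, 1, 2] : Fin 4 → Fin 3)
    (!![1, 1 / 100, 0, 0; 1 / 100, 1, 1 / 100, 0; 0, 1 / 100, 1, 1 / 100; 0, 0, 1 / 100, 1] : Matrix (Fin 4) (Fin 4) ℝ)
    (0 : Fin 4 → ℝ) adj χ p ek (∅ : Finset Unit) (fun _ _ => (0 : ℝ)) (fun _ => (1 : ℝ)) (univ : Finset Unit)
    (fun _ φ => (1 / 1000 : ℝ) * Real.exp (-(φ 0) ^ 2)) (fun _ : ↥(∅ : Finset Unit) ⊕ ↥(univ : Finset Unit) => (0 : Fin 3))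
    hΔ (by norm_num) hΔm (fun b => absurd b.2 (notMem_empty _))
    (fun Y φ ψ h => by show (1 / 1000 : ℝ) * Real.exp (-(φ 0) ^ 2) = (1 / 1000) * Real.exp (-(ψ 0) ^ 2); rw [h 0 rfl])
    (fun _ _ => hVm) (KY := fun _ => (1 / 1000 : ℝ)) (fun _ _ φ => hVb φ) (K₁ := 1 / 1000) (by norm_num) (fun _ _ => le_rfl) (G := 1) hG
    (θ := 1 / 10) (β' := 1) (by norm_num) (by norm_num) zero_le_one hvac hKθ₂ (W := 2) hW (R := 1 / 100) (by norm_num) hR rfl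
    ({0, 1, 2} : Finset (Fin 3)) (a := 0) (b := 1) (n := 2) (by decide) (by decide) (by decide) (by decide) (by decide) (by decide)
    (fun b' => absurd b'.2 (notMem_empty _)) (fun _ _ => rfl) toy_nbr
    (fun x l : Fin 4 => if x = l then 0 else 1) (c₁ := 2) (δ := 1 / 100) (by norm_num) (by norm_num) (by norm_num) toy_depth
    (univ : Finset (Fin 3)) X (fun s hs _ x l => toy_decay s hs x l) (by rw [Real.rpow_one]; norm_num) (by rw [Real.rpow_one]; norm_num)
    ht0 ht1 γ H

/-- **NON-VACUITY OF THE SIZE-UNIFORM CHAIN INSTANCE WITH A SOURCE**: `BIJ88Ineq5144EndChainNSource.ineq5144_locAct_endChainN_source_of_decay`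
applied to the datum with the constant source `ℱ ≡ 10⁻²`, every hypothesis — neighbour clause, depth clause, (b) and (c) for all `s`, the two
size-free clauses with `c₂ = 400/49`, `F = 10⁻²` — discharged by the kernel. [cite: BalabanImbrieJaffe1988, (5.14.4) p.309–310; p.305, p.307 (Sect. 5.13)] -/
theorem ineq5144_locAct_endChainN_source_of_decay_toy (adj : Fin 3 → Fin 3 → Prop) [DecidableRel adj] (χ : CutoffProfile) (p ek : ℝ)
    (X : Finset (Fin 3)) {t : ℝ} (ht0 : 0 ≤ t) (ht1 : t ≤ 1) {L : Type} [DecidableEq L]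
    (γ : L → ↥(slotB (∅ : Finset Unit) (univ : Finset Unit) (fun _ : ↥(∅ : Finset Unit) ⊕ ↥(univ : Finset Unit) => (0 : Fin 3)) X) ⊕
      ↥(slotY (∅ : Finset Unit) (univ : Finset Unit) (fun _ : ↥(∅ : Finset Unit) ⊕ ↥(univ : Finset Unit) => (0 : Fin 3)) X))
    (H : Finset L) :
    |locAct (cubeIn (fun _ : ↥(∅ : Finset Unit) ⊕ ↥(univ : Finset Unit) => (0 : Fin 3)) X ∘ γ)
        (actIn (![0, 1, 1, 2] : Fin 4 → Fin 3)
          (!![1, 1 / 100, 0, 0; 1 / 100, 1, 1 / 100, 0; 0, 1 / 100, 1, 1 / 100; 0, 0, 1 / 100, 1] : Matrix (Fin 4) (Fin 4) ℝ)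
          (fun _ : Fin 4 => (1 / 100 : ℝ)) adj χ p ek (∅ : Finset Unit) (fun _ _ => (0 : ℝ)) (fun _ => (1 : ℝ)) (univ : Finset Unit)
          (fun _ φ => (1 / 1000 : ℝ) * Real.exp (-(φ 0) ^ 2)) (fun _ : ↥(∅ : Finset Unit) ⊕ ↥(univ : Finset Unit) => (0 : Fin 3))
          (univ : Finset (Fin 3)) X t γ) H ({0, 1, 2} : Finset (Fin 3))| ≤
      (1 / 10 : ℝ) ^ ((H.card : ℝ) + 1 * ((({0, 1, 2} : Finset (Fin 3)) \
        H.image (cubeIn (fun _ : ↥(∅ : Finset Unit) ⊕ ↥(univ : Finset Unit) => (0 : Fin 3)) X ∘ γ)).card : ℝ)) := by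
  obtain ⟨hΔ, hΔm⟩ := toy_posDef_and_ge
  have hVm : Measurable fun φ : Fin 4 → ℝ => (1 / 1000 : ℝ) * Real.exp (-(φ 0) ^ 2) := Continuous.measurable (by fun_prop)
  have hVb : ∀ φ : Fin 4 → ℝ, |(1 / 1000 : ℝ) * Real.exp (-(φ 0) ^ 2)| ≤ 1 / 1000 := fun φ => by
    rw [abs_of_nonneg (by positivity)]
    exact mul_le_of_le_one_right (by norm_num) (Real.exp_le_one_iff.2 (neg_nonpos.2 (sq_nonneg _)))
  have hG : ∀ i : Fin 3, (univ.filter fun τ : ↥(∅ : Finset Unit) ⊕ ↥(univ : Finset Unit) =>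
      (fun _ : ↥(∅ : Finset Unit) ⊕ ↥(univ : Finset Unit) => (0 : Fin 3)) τ = i).card ≤ 1 := fun i =>
    (card_le_univ _).trans (by simp)
  have hexp : Real.exp (2 * ((1 : ℕ) : ℝ) * (1 / 1000)) ≤ 1 + 4 / 1000 := by
    have h := (abs_le.1 (Real.abs_exp_sub_one_le (x := 2 * ((1 : ℕ) : ℝ) * (1 / 1000)) (by norm_num))).2
    rw [abs_of_pos (by norm_num)] at h
    norm_num at h ⊢
    linarith
  have hvac : Real.exp (2 * ((1 : ℕ) : ℝ) * (1 / 1000)) - 1 ≤ (1 / 10 : ℝ) ^ (2 * (1 : ℝ)) / 2 := by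
    rw [show (2 : ℝ) * 1 = (2 : ℕ) by norm_num, Real.rpow_natCast]; norm_num; linarith
  have hKθ₂ : ∀ Y ∈ (univ : Finset Unit), (fun _ : Unit => (1 / 1000 : ℝ)) Y * Real.exp (2 * ((1 : ℕ) : ℝ) * (1 / 1000)) ≤
      (1 / 10 : ℝ) ^ ((1 : ℝ) + 1) / 2 := fun _ _ => by
    rw [show (1 : ℝ) + 1 = (2 : ℕ) by norm_num, Real.rpow_natCast]
    calc (1 / 1000 : ℝ) * Real.exp (2 * ((1 : ℕ) : ℝ) * (1 / 1000)) ≤ (1 / 1000) * (1 + 4 / 1000) :=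
          mul_le_mul_of_nonneg_left hexp (by norm_num)
      _ ≤ (1 / 10 : ℝ) ^ 2 / 2 := by norm_num
  have hW : ∀ i : Fin 3, (univ.filter fun x : Fin 4 => (![0, 1, 1, 2] : Fin 4 → Fin 3) x = i).card ≤ 2 := by decide
  have hR : ∀ x : Fin 4, ∑ y ∈ univ.filter (fun y => (![0, 1, 1, 2] : Fin 4 → Fin 3) y ≠ (![0, 1, 1, 2] : Fin 4 → Fin 3) x),
      |(!![1, 1 / 100, 0, 0; 1 / 100, 1, 1 / 100, 0; 0, 1 / 100, 1, 1 / 100; 0, 0, 1 / 100, 1] : Matrix (Fin 4) (Fin 4) ℝ) x y| ≤ 1 / 100 := by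
    intro x
    rw [Finset.sum_filter, Fin.sum_univ_four]
    fin_cases x <;> simp
  exact ineq5144_locAct_endChainN_source_of_decay (![0, 1, 1, 2] : Fin 4 → Fin 3)
    (!![1, 1 / 100, 0, 0; 1 / 100, 1, 1 / 100, 0; 0, 1 / 100, 1, 1 / 100; 0, 0, 1 / 100, 1] : Matrix (Fin 4) (Fin 4) ℝ)
    (fun _ : Fin 4 => (1 / 100 : ℝ)) adj χ p ek (∅ : Finset Unit) (fun _ _ => (0 : ℝ)) (fun _ => (1 : ℝ)) (univ : Finset Unit)
    (fun _ φ => (1 / 1000 : ℝ) * Real.exp (-(φ 0) ^ 2)) (fun _ : ↥(∅ : Finset Unit) ⊕ ↥(univ : Finset Unit) => (0 : Fin 3))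
    hΔ (by norm_num) hΔm (fun b => absurd b.2 (notMem_empty _))
    (fun Y φ ψ h => by show (1 / 1000 : ℝ) * Real.exp (-(φ 0) ^ 2) = (1 / 1000) * Real.exp (-(ψ 0) ^ 2); rw [h 0 rfl])
    (fun _ _ => hVm) (KY := fun _ => (1 / 1000 : ℝ)) (fun _ _ φ => hVb φ) (K₁ := 1 / 1000) (by norm_num) (fun _ _ => le_rfl) (G := 1) hG
    (θ := 1 / 10) (β' := 1) (by norm_num) (by norm_num) zero_le_one hvac hKθ₂ (W := 2) hW (R := 1 / 100) (by norm_num) hR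
    (F := 1 / 100) (by norm_num) (fun _ => le_of_eq (abs_of_pos (by norm_num)))
    ({0, 1, 2} : Finset (Fin 3)) (a := 0) (b := 1) (n := 2) (by decide) (by decide) (by decide) (by decide) (by decide) (by decide)
    (fun b' => absurd b'.2 (notMem_empty _)) (fun _ _ => rfl) toy_nbr
    (fun x l : Fin 4 => if x = l then 0 else 1) (c₁ := 2) (δ := 1 / 100) (by norm_num) (by norm_num) (by norm_num) toy_depth
    (univ : Finset (Fin 3)) X (fun s hs _ x l => toy_decay s hs x l) (c₂ := 400 / 49) (by norm_num)
    (fun s hs _ x => (toy_rowSum s hs).1 x) (fun s hs _ k _ => (toy_rowSum s hs).2 k)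
    (by rw [Real.rpow_one]; norm_num) (by rw [Real.rpow_one]; norm_num) ht0 ht1 γ H

/-- **NON-VACUITY OF THE PRINT'S-COUNT INSTANCE**: `BIJ88Ineq5144EndChainNWalkCount.ineq5144_locAct_endChainN_of_decay_walkCount` applied to the
datum — the plain per-derivative clause `10⁻³e^{2·10⁻³} ≤ θ/2`, the one-cube vacuum clause `e^{2·10⁻³} − 1 ≤ θ^{β′}/2` and the strengthened regime
base clause `4W³R³c₁²δ² ≤ mθ^{2β′}` discharged with the others; the statement displays these two clauses evaluated on the datum as conjuncts.
[cite: BalabanImbrieJaffe1988, (5.14.4) p.309–310; p.307 (Sect. 5.13)] -/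
theorem ineq5144_locAct_endChainN_walkCount_toy (adj : Fin 3 → Fin 3 → Prop) [DecidableRel adj] (χ : CutoffProfile) (p ek : ℝ)
    (X : Finset (Fin 3)) {t : ℝ} (ht0 : 0 ≤ t) (ht1 : t ≤ 1) {L : Type} [DecidableEq L]
    (γ : L → ↥(slotB (∅ : Finset Unit) (univ : Finset Unit) (fun _ : ↥(∅ : Finset Unit) ⊕ ↥(univ : Finset Unit) => (0 : Fin 3)) X) ⊕
      ↥(slotY (∅ : Finset Unit) (univ : Finset Unit) (fun _ : ↥(∅ : Finset Unit) ⊕ ↥(univ : Finset Unit) => (0 : Fin 3)) X))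
    (H : Finset L) :
    ((1 / 1000 : ℝ) * Real.exp (2 * ((1 : ℕ) : ℝ) * (1 / 1000)) ≤ (1 / 10 : ℝ) / 2 ∧
      4 * (((2 : ℕ) : ℝ) ^ 3 * (1 / 100 : ℝ) ^ 3 * (2 : ℝ) ^ 2 * (1 / 100 : ℝ) ^ 2) ≤ 98 / 100 * (1 / 10 : ℝ) ^ (2 * (1 : ℝ))) ∧
    |locAct (cubeIn (fun _ : ↥(∅ : Finset Unit) ⊕ ↥(univ : Finset Unit) => (0 : Fin 3)) X ∘ γ)
        (actIn (![0, 1, 1, 2] : Fin 4 → Fin 3)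
          (!![1, 1 / 100, 0, 0; 1 / 100, 1, 1 / 100, 0; 0, 1 / 100, 1, 1 / 100; 0, 0, 1 / 100, 1] : Matrix (Fin 4) (Fin 4) ℝ)
          (0 : Fin 4 → ℝ) adj χ p ek (∅ : Finset Unit) (fun _ _ => (0 : ℝ)) (fun _ => (1 : ℝ)) (univ : Finset Unit)
          (fun _ φ => (1 / 1000 : ℝ) * Real.exp (-(φ 0) ^ 2)) (fun _ : ↥(∅ : Finset Unit) ⊕ ↥(univ : Finset Unit) => (0 : Fin 3))
          (univ : Finset (Fin 3)) X t γ) H ({0, 1, 2} : Finset (Fin 3))| ≤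
      (1 / 10 : ℝ) ^ ((H.card : ℝ) + 1 * ((({0, 1, 2} : Finset (Fin 3)) \
        H.image (cubeIn (fun _ : ↥(∅ : Finset Unit) ⊕ ↥(univ : Finset Unit) => (0 : Fin 3)) X ∘ γ)).card : ℝ)) := by
  obtain ⟨hΔ, hΔm⟩ := toy_posDef_and_ge
  have hVm : Measurable fun φ : Fin 4 → ℝ => (1 / 1000 : ℝ) * Real.exp (-(φ 0) ^ 2) := Continuous.measurable (by fun_prop)
  have hVb : ∀ φ : Fin 4 → ℝ, |(1 / 1000 : ℝ) * Real.exp (-(φ 0) ^ 2)| ≤ 1 / 1000 := fun φ => by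
    rw [abs_of_nonneg (by positivity)]
    exact mul_le_of_le_one_right (by norm_num) (Real.exp_le_one_iff.2 (neg_nonpos.2 (sq_nonneg _)))
  have hG : ∀ i : Fin 3, (univ.filter fun τ : ↥(∅ : Finset Unit) ⊕ ↥(univ : Finset Unit) =>
      (fun _ : ↥(∅ : Finset Unit) ⊕ ↥(univ : Finset Unit) => (0 : Fin 3)) τ = i).card ≤ 1 := fun i =>
    (card_le_univ _).trans (by simp)
  have hexp : Real.exp (2 * ((1 : ℕ) : ℝ) * (1 / 1000)) ≤ 1 + 4 / 1000 := by
    have h := (abs_le.1 (Real.abs_exp_sub_one_le (x := 2 * ((1 : ℕ) : ℝ) * (1 / 1000)) (by norm_num))).2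
    rw [abs_of_pos (by norm_num)] at h
    norm_num at h ⊢
    linarith
  have hvac₁ : Real.exp (2 * ((1 : ℕ) : ℝ) * (1 / 1000)) - 1 ≤ (1 / 10 : ℝ) ^ (1 : ℝ) / 2 := by
    rw [Real.rpow_one]; linarith
  have hKθ : ∀ Y ∈ (univ : Finset Unit), (fun _ : Unit => (1 / 1000 : ℝ)) Y * Real.exp (2 * ((1 : ℕ) : ℝ) * (1 / 1000)) ≤
      (1 / 10 : ℝ) / 2 := fun _ _ => by
    calc (1 / 1000 : ℝ) * Real.exp (2 * ((1 : ℕ) : ℝ) * (1 / 1000)) ≤ (1 / 1000) * (1 + 4 / 1000) :=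
          mul_le_mul_of_nonneg_left hexp (by norm_num)
      _ ≤ (1 / 10 : ℝ) / 2 := by norm_num
  have hW : ∀ i : Fin 3, (univ.filter fun x : Fin 4 => (![0, 1, 1, 2] : Fin 4 → Fin 3) x = i).card ≤ 2 := by decide
  have hR : ∀ x : Fin 4, ∑ y ∈ univ.filter (fun y => (![0, 1, 1, 2] : Fin 4 → Fin 3) y ≠ (![0, 1, 1, 2] : Fin 4 → Fin 3) x),
      |(!![1, 1 / 100, 0, 0; 1 / 100, 1, 1 / 100, 0; 0, 1 / 100, 1, 1 / 100; 0, 0, 1 / 100, 1] : Matrix (Fin 4) (Fin 4) ℝ) x y| ≤ 1 / 100 := by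
    intro x
    rw [Finset.sum_filter, Fin.sum_univ_four]
    fin_cases x <;> simp
  have hbase : 4 * (((2 : ℕ) : ℝ) ^ 3 * (1 / 100 : ℝ) ^ 3 * (2 : ℝ) ^ 2 * (1 / 100 : ℝ) ^ 2) ≤ 98 / 100 * (1 / 10 : ℝ) ^ (2 * (1 : ℝ)) := by
    rw [show (2 : ℝ) * 1 = (2 : ℕ) by norm_num, Real.rpow_natCast]; norm_num
  refine ⟨⟨hKθ () (mem_univ _), hbase⟩, ?_⟩
  exact ineq5144_locAct_endChainN_of_decay_walkCount (![0, 1, 1, 2] : Fin 4 → Fin 3)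
    (!![1, 1 / 100, 0, 0; 1 / 100, 1, 1 / 100, 0; 0, 1 / 100, 1, 1 / 100; 0, 0, 1 / 100, 1] : Matrix (Fin 4) (Fin 4) ℝ)
    (0 : Fin 4 → ℝ) adj χ p ek (∅ : Finset Unit) (fun _ _ => (0 : ℝ)) (fun _ => (1 : ℝ)) (univ : Finset Unit)
    (fun _ φ => (1 / 1000 : ℝ) * Real.exp (-(φ 0) ^ 2)) (fun _ : ↥(∅ : Finset Unit) ⊕ ↥(univ : Finset Unit) => (0 : Fin 3))
    hΔ (by norm_num) hΔm (fun b => absurd b.2 (notMem_empty _))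
    (fun Y φ ψ h => by show (1 / 1000 : ℝ) * Real.exp (-(φ 0) ^ 2) = (1 / 1000) * Real.exp (-(ψ 0) ^ 2); rw [h 0 rfl])
    (fun _ _ => hVm) (KY := fun _ => (1 / 1000 : ℝ)) (fun _ _ φ => hVb φ) (K₁ := 1 / 1000) (by norm_num) (fun _ _ => le_rfl) (G := 1) hG
    (θ := 1 / 10) (β' := 1) (by norm_num) (by norm_num) zero_le_one hvac₁ hKθ (W := 2) hW (R := 1 / 100) (by norm_num) hR rfl
    ({0, 1, 2} : Finset (Fin 3)) (a := 0) (b := 1) (n := 2) (by decide) (by decide) (by decide) (by decide) (by decide) (by decide)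
    (fun b' => absurd b'.2 (notMem_empty _)) (fun _ _ => rfl) toy_nbr
    (fun x l : Fin 4 => if x = l then 0 else 1) (c₁ := 2) (δ := 1 / 100) (by norm_num) (by norm_num) (by norm_num) toy_depth
    (univ : Finset (Fin 3)) X (fun s hs _ x l => toy_decay s hs x l) hbase (by rw [Real.rpow_one]; norm_num) ht0 ht1 γ H

end Literature.MathematicalPhysics.QuantumFieldTheory.BalabanImbrieJaffe1984to88.BIJ88Ineq5144EndChainNToy

end
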